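import Summits.AtomisticToContinuum.Crystallization.Theorems.FrustratedLawDichotomyStrainedPatchRowPrice

/-!
# GradStep — the GLOBAL host-step certificate in TABLE CURRENCY (lens-5 g76, «finite/base range + asymptotic regime + bridge»)

The per-row host step `HostStepTab 𝓘 τ σ B T r H F Y P` (g75, in tree) asks, per host cell, occupancy and MAYBE-reach row `h`, for
`sup hostQuad(h)` over the GLOBAL row polytope {`D` : `‖D‖ ≤ τ` on `O`, `D c₀ = 0`, `‖hostLin(h')‖ ≤ σ + Y(h')` at every SURE-reach row}.
The census (ASK-73 (V6)) found every LOCAL truncation of that sup worthless (a free `τ`-boundary re-appears at the truncation radius) and the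
global Shor SDP (`n ≈ 4 800`) out of reach.  This module types the certificate format that keeps the polytope GLOBAL but makes every
instrument a LINEAR programme:

* §1 `HostDiffTab` — per-pair FIRST-DIFFERENCE tables `‖D h' − D h‖ ≤ G(h, h')` on the global polytope [INSTRUMENTABLE: one linear-objective sup
  per (row, near partner, direction) over the global polytope — an LP/SOCP in `3|O|` variables, certified by directed rounding of the dual];
  `diffEval` — the closed-form evaluation `½ Σ ‖B‖·G² + Σ T(·, G)`; ★ `hostQuad_le_diffEval` and ★★ `hostStepTab_of_diffTab` [PROVED bridge];
  the BASE RANGE `boxTab τ = 2τ` is a valid table on every host [PROVED, `hostDiffTab_box`], so the START table is recovered in the same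
  currency (`hostTopTab_of_diffEvalTab_box`), and the depth glue `depthTab δ G_in G_out` [PROVED, `hostDiffTab_depth`] splits the rows into the
  COLLAR (box tables) and the INTERIOR REGIME `dist(h, c₀) ≤ 63/10 − δ` (decayed tables) — the lens's dial is the depth `δ`.
* §2 THE PAIRING IDENTITY ON (NEAR-)CENTROSYMMETRIC SHELLS: for a bilinear map symmetric in its two slots,
  `A v v + A' w w = (A + A') w w + A (v − w) (v + w)` [PROVED, `pair_split`]; `bondD3 x` is symmetric and ODD in `x` [PROVED, `bondD3_symm`,
  `bondD3_neg`, `bondD3_add_neg`], so on an exactly centrosymmetric shell the paired quadratic price is BILINEAR in the across-pair first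
  difference `D h' − D h''` and the SECOND difference `D h' + D h'' − 2 D h` — for the smooth (harmonic-extension) fields the global polytope
  allows in the interior these are `O(τ·d/depth)` and `O(τ·(d/depth)²)`, not `2τ` and `4τ`.
* §3 `HostPairTab` (across-pair first and second difference tables, again LINEAR objectives on the global polytope), `pairEval`, ★★
  `norm_half_sum_le_pair` / `hostQuad_le_pairEval` and ★★★ `hostStepTab_of_pairTab` [PROVED bridge]; box tables `2τ / 4τ` valid [PROVED].
* §4 The T-leaf record in this currency: ★★★ `coreOff_of_envelope_tailCert_pairTabs` — `[CORE-FAR]` from the cover, the separation / far / tail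
  data of R1⁗, the START table certified by box evaluation, and a finite sequence of stages each certified by (difference tables on the
  column `addCol X (P i)`, pair tables, table arithmetic), terminal `SlackCert` on `addCol X (P n)` — i.e. `coreOff_of_envelope_tailCert_tab`
  with every `HostStepTab` stage discharged by LPs + arithmetic instead of an SDP.

Every theorem here is formal bookkeeping over the g73/g75 host objects plus two lines of bilinear algebra; the mathematics the format
leaves to the census (or to a later analytic node) is the SIZE of the difference tables in the interior regime (discrete Saint-Venant decay).
-/

namespace Summit.AtomisticToContinuum.Crystallization.Theorems.FrustratedLawDichotomyStrainedPatchGradStep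

open scoped BigOperators Classical RealInnerProductSpace
open Summit.AtomisticToContinuum.Crystallization.Theorems.FrustratedLawDichotomyMotifLemmas
open Summit.AtomisticToContinuum.Crystallization.Theorems.FrustratedLawDichotomyRangeCut
open Summit.AtomisticToContinuum.Crystallization.Theorems.FrustratedLawDichotomyAveragingCut
open Summit.AtomisticToContinuum.Crystallization.Theorems.FrustratedLawDichotomyStrainedPatchHomSplit
open Summit.AtomisticToContinuum.Crystallization.Theorems.FrustratedLawDichotomyStrainedPatchCleanCollar
open Summit.AtomisticToContinuum.Crystallization.Theorems.FrustratedLawDichotomyStrainedPatchPhaseCut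
open Summit.AtomisticToContinuum.Crystallization.Theorems.FrustratedLawDichotomyStrainedPatchCoreTube
open Summit.AtomisticToContinuum.Crystallization.Theorems.FrustratedLawDichotomyStrainedPatchStrainBands
open Summit.AtomisticToContinuum.Crystallization.Theorems.FrustratedLawDichotomyStrainedPatchHomIsometry
open Summit.AtomisticToContinuum.Crystallization.Theorems.FrustratedLawDichotomyStrainedPatchHomTubeIso
open Summit.AtomisticToContinuum.Crystallization.Theorems.FrustratedLawDichotomyStrainedPatchEnvelopeLaw
open Summit.AtomisticToContinuum.Crystallization.Theorems.FrustratedLawDichotomyStrainedPatchEnvelopeTaylor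
open Summit.AtomisticToContinuum.Crystallization.Theorems.FrustratedLawDichotomyStrainedPatchChartFamilies
open Summit.AtomisticToContinuum.Crystallization.Theorems.FrustratedLawDichotomyStrainedPatchChartFamiliesPinned
open Summit.AtomisticToContinuum.Crystallization.Theorems.FrustratedLawDichotomyStrainedPatchQuantSlaving
open Summit.AtomisticToContinuum.Crystallization.Theorems.FrustratedLawDichotomyStrainedPatchHostCells
open Summit.AtomisticToContinuum.Crystallization.Theorems.FrustratedLawDichotomyStrainedPatchForceCap
open Summit.AtomisticToContinuum.Crystallization.Theorems.FrustratedLawDichotomyStrainedPatchTextureFloor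
open Summit.AtomisticToContinuum.Crystallization.Theorems.FrustratedLawDichotomyStrainedPatchSVCharge
open Summit.AtomisticToContinuum.Crystallization.Theorems.FrustratedLawDichotomyStrainedPatchChargePrice
open Summit.AtomisticToContinuum.Crystallization.Theorems.FrustratedLawDichotomyStrainedPatchTaylorTop
open Summit.AtomisticToContinuum.Crystallization.Theorems.FrustratedLawDichotomyStrainedPatchTaylorCharge
open Summit.AtomisticToContinuum.Crystallization.Theorems.FrustratedLawDichotomyStrainedPatchHostStep
open Summit.AtomisticToContinuum.Crystallization.Theorems.FrustratedLawDichotomyStrainedPatchBondCalculus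
open Summit.AtomisticToContinuum.Crystallization.Theorems.FrustratedLawDichotomyStrainedPatchFarSplit
open Summit.AtomisticToContinuum.Crystallization.Theorems.FrustratedLawDichotomyStrainedPatchTailPacking
open Summit.AtomisticToContinuum.Crystallization.Theorems.FrustratedLawDichotomyStrainedPatchRimFold
open Summit.AtomisticToContinuum.Crystallization.Theorems.FrustratedLawDichotomyStrainedPatchRowPrice

/-! ## §1. First-difference tables on the GLOBAL row polytope, the closed-form evaluation, the bridge to `HostStepTab` -/

/-- A PER-PAIR DIFFERENCE TABLE: `G(z₀)(c₀)(h, h')` bounds a difference of the displacement field attached to the pair `(h, h')` of a host. -/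
abbrev DiffTab := (M₀ : ℕ) → (Fin M₀ → E3) → Fin M₀ → Fin M₀ → Fin M₀ → ℝ

/-- A PAIRING MAP (census datum): per host, centre, occupancy and row `h`, the partner `Pm(h') ∈ hostNear` of a near site `h'` — on a centrosymmetric
shell the site nearest to `2 z₀ h − z₀ h'`; an unpaired site is its own partner. -/
abbrev PairMap := (M₀ : ℕ) → (Fin M₀ → E3) → Fin M₀ → Finset (Fin M₀) → Fin M₀ → Fin M₀ → Fin M₀

/-- Monotonicity of the tail price in its second (displacement) argument on `[0, ∞)`. -/
def TMono (T : ℝ → ℝ → ℝ) : Prop := ∀ s a b : ℝ, 0 ≤ a → a ≤ b → T s a ≤ T s b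

/-- The cubic tail `cubicTail L s μ = L(s)·μ³/6` is monotone in `μ ≥ 0` when `L ≥ 0`. [formal bookkeeping] -/
theorem tMono_cubicTail {L : ℝ → ℝ} (hL : ∀ s, 0 ≤ L s) : TMono (cubicTail L) := by
  intro s a b ha hab
  unfold cubicTail
  have h3 : a ^ 3 ≤ b ^ 3 := pow_le_pow_left₀ ha hab 3
  have := mul_le_mul_of_nonneg_left h3 (hL s)
  linarith

/-- `gammaMaj ≥ 0` everywhere (even inverse powers). [formal bookkeeping] -/
theorem gammaMaj_nonneg (a : ℝ) : 0 ≤ gammaMaj a := by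
  unfold gammaMaj
  have h16 : 0 ≤ a⁻¹ ^ 16 := by positivity
  have h10 : 0 ≤ a⁻¹ ^ 10 := by positivity
  have h₁ : 0 ≤ max (4032 * a⁻¹ ^ 16) (960 * a⁻¹ ^ 10) := le_max_of_le_left (by positivity)
  have h₂ : 0 ≤ max (224 * a⁻¹ ^ 16) (80 * a⁻¹ ^ 10) := le_max_of_le_left (by positivity)
  have h₃ : 0 ≤ max (14 * a⁻¹ ^ 16) (8 * a⁻¹ ^ 10) := le_max_of_le_left (by positivity)
  linarith

/-- The γ-envelope cubic tail of R1⁗ is monotone. [formal bookkeeping] -/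
theorem tMono_cubicTail_gammaMaj (τ : ℝ) : TMono (cubicTail fun s => gammaMaj (s - 2 * τ)) :=
  tMono_cubicTail fun _ => gammaMaj_nonneg _

/-- ★ **(HDIFF) `HostDiffTab 𝓘 τ σ r H F Y G`** [INSTRUMENTABLE · one LINEAR-objective sup per (host cell, occupancy, maybe-reach row, near partner,
direction) over the GLOBAL row polytope]: on every instance, every admissible host reading whose SURE-reach rows satisfy `‖hostLin‖ ≤ σ + Y`, every
MAYBE-reach row `h` and every near partner `h' ∈ hostNear r`, `‖D h' − D h‖ ≤ G(z₀)(c₀)(h, h')`. -/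
def HostDiffTab (𝓘 : ChartFam) (τ σ r : ℝ) (H : HessTab) (F : ForceTab) (Y : SlackTab) (G : DiffTab) : Prop :=
  ∀ (M₀ : ℕ) (z₀ : Fin M₀ → E3) (c₀ : Fin M₀), 𝓘 M₀ z₀ c₀ → ∀ (O : Finset (Fin M₀)) (D : Fin M₀ → E3), HostReading τ z₀ c₀ O D →
    (∀ h ∈ O, HostSureReach τ z₀ c₀ O h → ‖hostLin H F z₀ c₀ O D h‖ ≤ σ + Y M₀ z₀ c₀ h) →
      ∀ h ∈ O, HostMaybeReach τ z₀ c₀ O h → ∀ h' ∈ hostNear r z₀ O h, ‖D h' - D h‖ ≤ G M₀ z₀ c₀ h h'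

/-- (HDIFF-in δ) — the same, asserted only for the INTERIOR rows `dist(z₀ h, z₀ c₀) ≤ 63/10 − δ` [INSTRUMENTABLE · the asymptotic regime where the
decay of rough components below the rim makes the tables small]. -/
def HostDiffTabIn (𝓘 : ChartFam) (τ σ r : ℝ) (H : HessTab) (F : ForceTab) (Y : SlackTab) (δ : ℝ) (G : DiffTab) : Prop :=
  ∀ (M₀ : ℕ) (z₀ : Fin M₀ → E3) (c₀ : Fin M₀), 𝓘 M₀ z₀ c₀ → ∀ (O : Finset (Fin M₀)) (D : Fin M₀ → E3), HostReading τ z₀ c₀ O D →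
    (∀ h ∈ O, HostSureReach τ z₀ c₀ O h → ‖hostLin H F z₀ c₀ O D h‖ ≤ σ + Y M₀ z₀ c₀ h) →
      ∀ h ∈ O, HostMaybeReach τ z₀ c₀ O h → dist (z₀ h) (z₀ c₀) ≤ 63 / 10 - δ → ∀ h' ∈ hostNear r z₀ O h, ‖D h' - D h‖ ≤ G M₀ z₀ c₀ h h'

/-- The BOX TABLE `2τ` (base range). -/
def boxTab (τ : ℝ) : DiffTab := fun _ _ _ _ _ => 2 * τ

/-- The DEPTH GLUE of an interior table and a collar table at depth `δ`. -/
noncomputable def depthTab (δ : ℝ) (Gin Gout : DiffTab) : DiffTab := fun M₀ z₀ c₀ h h' =>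
  if dist (z₀ h) (z₀ c₀) ≤ 63 / 10 - δ then Gin M₀ z₀ c₀ h h' else Gout M₀ z₀ c₀ h h'

/-- Near partners are occupied. [formal bookkeeping] -/
theorem mem_of_mem_hostNear {r : ℝ} {M₀ : ℕ} {z₀ : Fin M₀ → E3} {O : Finset (Fin M₀)} {h h' : Fin M₀} (hh' : h' ∈ hostNear r z₀ O h) : h' ∈ O :=
  (Finset.mem_filter.1 hh').1

/-- The box bound `‖D h' − D h‖ ≤ 2τ` on an admissible host reading. [formal bookkeeping: `‖D‖ ≤ τ` on `O`] -/
theorem diff_le_box {τ r : ℝ} {M₀ : ℕ} {z₀ : Fin M₀ → E3} {c₀ : Fin M₀} {O : Finset (Fin M₀)} {D : Fin M₀ → E3} (hR : HostReading τ z₀ c₀ O D)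
    {h h' : Fin M₀} (hh : h ∈ O) (hh' : h' ∈ hostNear r z₀ O h) : ‖D h' - D h‖ ≤ boxTab τ M₀ z₀ c₀ h h' := by
  have h₁ := hR.2.2.2.1 h' (mem_of_mem_hostNear hh')
  have h₂ := hR.2.2.2.1 h hh
  simp only [boxTab]
  linarith [norm_sub_le (D h') (D h)]

/-- ★ THE BASE RANGE: the box table `2τ` is a valid difference table on every host, column and radius. [formal bookkeeping] -/
theorem hostDiffTab_box (𝓘 : ChartFam) (τ σ r : ℝ) (H : HessTab) (F : ForceTab) (Y : SlackTab) : HostDiffTab 𝓘 τ σ r H F Y (boxTab τ) :=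
  fun _ _ _ _ _ _ hR _ _ hh _ _ hh' => diff_le_box hR hh hh'

/-- ★ THE DEPTH GLUE: an interior table below depth `δ` and any valid collar table give the glued table. [formal bookkeeping] -/
theorem hostDiffTab_depth {𝓘 : ChartFam} {τ σ r : ℝ} {H : HessTab} {F : ForceTab} {Y : SlackTab} {δ : ℝ} {Gin Gout : DiffTab}
    (hin : HostDiffTabIn 𝓘 τ σ r H F Y δ Gin) (hout : HostDiffTab 𝓘 τ σ r H F Y Gout) : HostDiffTab 𝓘 τ σ r H F Y (depthTab δ Gin Gout) := by
  intro M₀ z₀ c₀ hI O D hR hL h hh hm h' hh'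
  by_cases hd : dist (z₀ h) (z₀ c₀) ≤ 63 / 10 - δ
  · simp only [depthTab, if_pos hd]
    exact hin M₀ z₀ c₀ hI O D hR hL h hh hm hd h' hh'
  · simp only [depthTab, if_neg hd]
    exact hout M₀ z₀ c₀ hI O D hR hL h hh hm h' hh'

/-- (HDIFF) is MONOTONE in the table and ANTITONE in the column. [formal bookkeeping] -/
theorem HostDiffTab.mono {𝓘 : ChartFam} {τ σ r : ℝ} {H : HessTab} {F : ForceTab} {Y Y' : SlackTab} {G G' : DiffTab}
    (hY : ∀ (M₀ : ℕ) (z₀ : Fin M₀ → E3) (c₀ h : Fin M₀), Y' M₀ z₀ c₀ h ≤ Y M₀ z₀ c₀ h)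
    (hG : ∀ (M₀ : ℕ) (z₀ : Fin M₀ → E3) (c₀ h h' : Fin M₀), G M₀ z₀ c₀ h h' ≤ G' M₀ z₀ c₀ h h') (h : HostDiffTab 𝓘 τ σ r H F Y G) :
    HostDiffTab 𝓘 τ σ r H F Y' G' :=
  fun M₀ z₀ c₀ hI O D hR hL h₀ hh hm h' hh' =>
    (h M₀ z₀ c₀ hI O D hR (fun h'' hh'' hs => (hL h'' hh'' hs).trans (by linarith [hY M₀ z₀ c₀ h''])) h₀ hh hm h' hh').trans (hG M₀ z₀ c₀ h₀ h')

/-- THE CLOSED-FORM EVALUATION of the quadratic price under a difference bound `g` on the near partners of `h`: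
`½ Σ_{h'} ‖B(z₀ h' − z₀ h)‖·g(h')² + Σ_{h'} T(‖z₀ h' − z₀ h‖, g(h'))`. -/
noncomputable def diffEval (B : E3 → E3 →L[ℝ] E3 →L[ℝ] E3) (T : ℝ → ℝ → ℝ) (r : ℝ) {M₀ : ℕ} (z₀ : Fin M₀ → E3) (O : Finset (Fin M₀)) (g : Fin M₀ → ℝ)
    (h : Fin M₀) : ℝ :=
  (1 / 2 : ℝ) * ∑ h' ∈ hostNear r z₀ O h, ‖B (z₀ h' - z₀ h)‖ * g h' ^ 2 + ∑ h' ∈ hostNear r z₀ O h, T ‖z₀ h' - z₀ h‖ (g h')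

/-- `‖A v w‖ ≤ ‖A‖·a·b` from `‖v‖ ≤ a`, `‖w‖ ≤ b`. [formal bookkeeping] -/
theorem norm_bil_le (A : E3 →L[ℝ] E3 →L[ℝ] E3) {v w : E3} {a b : ℝ} (hv : ‖v‖ ≤ a) (hw : ‖w‖ ≤ b) : ‖A v w‖ ≤ ‖A‖ * a * b := by
  have hA : 0 ≤ ‖A‖ := norm_nonneg A
  have ha : 0 ≤ a := (norm_nonneg v).trans hv
  exact (A.le_opNorm₂ v w).trans (mul_le_mul (mul_le_mul_of_nonneg_left hv hA) hw (norm_nonneg w) (mul_nonneg hA ha))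

/-- ★ **THE FIRST-DIFFERENCE BRIDGE** — `hostQuad(h) ≤ diffEval(g)(h)` whenever `‖D h' − D h‖ ≤ g(h')` on the near partners (`T` monotone).
[formal bookkeeping: `‖½ Σ B v v‖ ≤ ½ Σ ‖B‖‖v‖²`] -/
theorem hostQuad_le_diffEval {B : E3 → E3 →L[ℝ] E3 →L[ℝ] E3} {T : ℝ → ℝ → ℝ} (hT : TMono T) {r : ℝ} {M₀ : ℕ} {z₀ : Fin M₀ → E3}
    {O : Finset (Fin M₀)} {D : Fin M₀ → E3} {h : Fin M₀} {g : Fin M₀ → ℝ} (hg : ∀ h' ∈ hostNear r z₀ O h, ‖D h' - D h‖ ≤ g h') :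
    hostQuad B T r z₀ O D h ≤ diffEval B T r z₀ O g h := by
  unfold hostQuad diffEval
  refine add_le_add ?_ (Finset.sum_le_sum fun h' hh' => hT _ _ _ (norm_nonneg _) (hg h' hh'))
  rw [norm_smul, Real.norm_of_nonneg (by norm_num : (0 : ℝ) ≤ 1 / 2)]
  refine mul_le_mul_of_nonneg_left ((norm_sum_le _ _).trans (Finset.sum_le_sum fun h' hh' => ?_)) (by norm_num)
  calc ‖B (z₀ h' - z₀ h) (D h' - D h) (D h' - D h)‖ ≤ ‖B (z₀ h' - z₀ h)‖ * g h' * g h' := norm_bil_le _ (hg h' hh') (hg h' hh')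
    _ = ‖B (z₀ h' - z₀ h)‖ * g h' ^ 2 := by ring

/-- ★ **(DEVAL) `DiffEvalTab 𝓘 τ B T r G P`** [INSTRUMENTABLE · closed-form arithmetic per host cell and occupancy]: the evaluation of the table `G` is
`≤ P` at every maybe-reach row. -/
def DiffEvalTab (𝓘 : ChartFam) (τ : ℝ) (B : E3 → E3 →L[ℝ] E3 →L[ℝ] E3) (T : ℝ → ℝ → ℝ) (r : ℝ) (G : DiffTab) (P : SlackTab) : Prop :=
  ∀ (M₀ : ℕ) (z₀ : Fin M₀ → E3) (c₀ : Fin M₀), 𝓘 M₀ z₀ c₀ → ∀ (O : Finset (Fin M₀)) (D : Fin M₀ → E3), HostReading τ z₀ c₀ O D →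
    ∀ h ∈ O, HostMaybeReach τ z₀ c₀ O h → diffEval B T r z₀ O (G M₀ z₀ c₀ h) h ≤ P M₀ z₀ c₀ h

/-- ★★ **`hostStepTab_of_diffTab`** — (HDIFF G on column Y) ∧ (DEVAL G ≤ P) ⟹ (HSTEP-tab Y P). [formal bookkeeping: the bridge] -/
theorem hostStepTab_of_diffTab {𝓘 : ChartFam} {τ σ r : ℝ} {B : E3 → E3 →L[ℝ] E3 →L[ℝ] E3} {T : ℝ → ℝ → ℝ} (hT : TMono T) {H : HessTab}
    {F : ForceTab} {Y P : SlackTab} {G : DiffTab} (hG : HostDiffTab 𝓘 τ σ r H F Y G) (hP : DiffEvalTab 𝓘 τ B T r G P) :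
    HostStepTab 𝓘 τ σ B T r H F Y P :=
  fun M₀ z₀ c₀ hI O D hR hL h hh hm =>
    (hostQuad_le_diffEval (g := G M₀ z₀ c₀ h) hT (hG M₀ z₀ c₀ hI O D hR hL h hh hm)).trans (hP M₀ z₀ c₀ hI O D hR h hh hm)

/-- ★ THE START TABLE IN THE SAME CURRENCY — (DEVAL box ≤ P) ⟹ (HTOP-tab P). [formal bookkeeping] -/
theorem hostTopTab_of_diffEvalTab_box {𝓘 : ChartFam} {τ r : ℝ} {B : E3 → E3 →L[ℝ] E3 →L[ℝ] E3} {T : ℝ → ℝ → ℝ} (hT : TMono T) {P : SlackTab}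
    (hP : DiffEvalTab 𝓘 τ B T r (boxTab τ) P) : HostTopTab 𝓘 τ B T r P := by
  intro M₀ z₀ c₀ hI O D hR h hh hm
  have hg : ∀ h' ∈ hostNear r z₀ O h, ‖D h' - D h‖ ≤ boxTab τ M₀ z₀ c₀ h h' := fun h' hh' => diff_le_box hR hh hh'
  have h₁ : hostQuad B T r z₀ O D h ≤ diffEval B T r z₀ O (boxTab τ M₀ z₀ c₀ h) h := hostQuad_le_diffEval hT hg
  exact h₁.trans (hP M₀ z₀ c₀ hI O D hR h hh hm)

/-! ## §2. The pairing identity on (near-)centrosymmetric shells -/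

/-- ★ **THE PAIRING IDENTITY**: for a bilinear map symmetric in its two slots, `A v v − A w w = A (v − w) (v + w)`. [two lines of bilinear algebra] -/
theorem pairing_identity (A : E3 →L[ℝ] E3 →L[ℝ] E3) (hA : ∀ u v : E3, A u v = A v u) (v w : E3) : A v v - A w w = A (v - w) (v + w) := by
  rw [map_sub, sub_apply, map_add, map_add, hA w v]
  abel

/-- ★ **THE PAIRED SPLIT**: `A v v + A' w w = (A + A') w w + A (v − w) (v + w)` — the paired quadratic price is an ASYMMETRY term (vanishing on an
exactly centrosymmetric shell, `A' = −A`) plus a term BILINEAR in the across-pair first difference and the second difference. -/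
theorem pair_split (A A' : E3 →L[ℝ] E3 →L[ℝ] E3) (hA : ∀ u v : E3, A u v = A v u) (v w : E3) :
    A v v + A' w w = (A + A') w w + A (v - w) (v + w) := by
  rw [← pairing_identity A hA v w, add_apply, add_apply]
  abel

/-- `bondD3 x` is symmetric in its two slots. [formal bookkeeping over the closed form] -/
theorem bondD3_symm (x u v : E3) : bondD3 x u v = bondD3 x v u := by
  rw [bondD3_apply_apply, bondD3_apply_apply, real_inner_comm v u]
  module

/-- `bondD3` is ODD in the bond vector: `bondD3 (−x) = −bondD3 x` (third derivative of an even pair potential). [formal bookkeeping] -/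
theorem bondD3_neg (x u v : E3) : bondD3 (-x) u v = -(bondD3 x u v) := by
  rw [bondD3_apply_apply, bondD3_apply_apply, norm_neg, inner_neg_left, inner_neg_left]
  module

/-- On an exactly centrosymmetric pair the asymmetry weight vanishes: `bondD3 x + bondD3 (−x) = 0`. [formal bookkeeping] -/
theorem bondD3_add_neg (x : E3) : bondD3 x + bondD3 (-x) = 0 :=
  ContinuousLinearMap.ext fun u => ContinuousLinearMap.ext fun v => by
    rw [add_apply, add_apply, bondD3_neg, zero_apply,
      zero_apply, add_neg_cancel]

/-- ★★ **THE PAIRED NORM BOUND** — for slot-symmetric `A`, an involutive pairing `π` of the index set `S`, and bounds `‖v‖ ≤ g`, `‖v − v∘π‖ ≤ g₁`,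
`‖v + v∘π‖ ≤ g₂` on `S`: `‖½ Σ_{S} A v v‖ ≤ ¼ Σ_{S} (‖A + A∘π‖·g(π·)² + ‖A‖·g₁·g₂)`. [reindexing by the involution + `pair_split` + operator norms] -/
theorem norm_half_sum_le_pair {M₀ : ℕ} (S : Finset (Fin M₀)) (A : Fin M₀ → E3 →L[ℝ] E3 →L[ℝ] E3) (hA : ∀ i, ∀ u v : E3, A i u v = A i v u)
    (v : Fin M₀ → E3) (π : Fin M₀ → Fin M₀) (hπS : ∀ i ∈ S, π i ∈ S) (hππ : ∀ i ∈ S, π (π i) = i) {g g₁ g₂ : Fin M₀ → ℝ}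
    (hg : ∀ i ∈ S, ‖v i‖ ≤ g i) (hg₁ : ∀ i ∈ S, ‖v i - v (π i)‖ ≤ g₁ i) (hg₂ : ∀ i ∈ S, ‖v i + v (π i)‖ ≤ g₂ i) :
    ‖(1 / 2 : ℝ) • ∑ i ∈ S, A i (v i) (v i)‖ ≤ (1 / 4 : ℝ) * ∑ i ∈ S, (‖A i + A (π i)‖ * g (π i) ^ 2 + ‖A i‖ * g₁ i * g₂ i) := by
  have hre : ∑ i ∈ S, A (π i) (v (π i)) (v (π i)) = ∑ i ∈ S, A i (v i) (v i) :=
    Finset.sum_nbij' π π hπS hπS hππ hππ (fun _ _ => rfl)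
  have hsum : ∑ i ∈ S, A i (v i) (v i) =
      (1 / 2 : ℝ) • ∑ i ∈ S, ((A i + A (π i)) (v (π i)) (v (π i)) + A i (v i - v (π i)) (v i + v (π i))) := by
    rw [show ∑ i ∈ S, ((A i + A (π i)) (v (π i)) (v (π i)) + A i (v i - v (π i)) (v i + v (π i))) =
        ∑ i ∈ S, (A i (v i) (v i) + A (π i) (v (π i)) (v (π i))) from
      Finset.sum_congr rfl fun i _ => (pair_split (A i) (A (π i)) (hA i) (v i) (v (π i))).symm,
      Finset.sum_add_distrib, hre, ← two_smul ℝ (∑ i ∈ S, A i (v i) (v i)), smul_smul]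
    norm_num
  rw [hsum, smul_smul, show (1 / 2 : ℝ) * (1 / 2) = 1 / 4 by norm_num, norm_smul, Real.norm_of_nonneg (by norm_num : (0 : ℝ) ≤ 1 / 4)]
  refine mul_le_mul_of_nonneg_left ((norm_sum_le _ _).trans (Finset.sum_le_sum fun i hi => (norm_add_le _ _).trans (add_le_add ?_ ?_)))
    (by norm_num)
  · calc ‖(A i + A (π i)) (v (π i)) (v (π i))‖ ≤ ‖A i + A (π i)‖ * g (π i) * g (π i) := norm_bil_le _ (hg _ (hπS i hi)) (hg _ (hπS i hi))
      _ = ‖A i + A (π i)‖ * g (π i) ^ 2 := by ring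
  · exact norm_bil_le _ (hg₁ i hi) (hg₂ i hi)

/-! ## §3. Pair tables on the GLOBAL row polytope, the paired evaluation, the bridge to `HostStepTab` -/

/-- The pairing map is ADMISSIBLE at radius `r`: it maps the near set of every row into itself involutively. [DECIDABLE bookkeeping per host] -/
def PairAdm (r : ℝ) (Pm : PairMap) : Prop :=
  ∀ (M₀ : ℕ) (z₀ : Fin M₀ → E3) (c₀ : Fin M₀) (O : Finset (Fin M₀)) (h : Fin M₀), ∀ h' ∈ hostNear r z₀ O h,
    Pm M₀ z₀ c₀ O h h' ∈ hostNear r z₀ O h ∧ Pm M₀ z₀ c₀ O h (Pm M₀ z₀ c₀ O h h') = h'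

/-- ★ **(HPAIR) `HostPairTab 𝓘 τ σ r H F Y Pm G₁ G₂`** [INSTRUMENTABLE · LINEAR-objective sups over the GLOBAL row polytope]: on every admissible host
reading satisfying the SURE-reach rows with column `Y`, for every MAYBE-reach row `h` and near partner `h'` with pair partner `h'' = Pm(h')`:
the ACROSS-PAIR FIRST DIFFERENCE `‖D h' − D h''‖ ≤ G₁(h, h')` and the SECOND DIFFERENCE `‖D h' + D h'' − 2·D h‖ ≤ G₂(h, h')`. -/
def HostPairTab (𝓘 : ChartFam) (τ σ r : ℝ) (H : HessTab) (F : ForceTab) (Y : SlackTab) (Pm : PairMap) (G₁ G₂ : DiffTab) : Prop :=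
  ∀ (M₀ : ℕ) (z₀ : Fin M₀ → E3) (c₀ : Fin M₀), 𝓘 M₀ z₀ c₀ → ∀ (O : Finset (Fin M₀)) (D : Fin M₀ → E3), HostReading τ z₀ c₀ O D →
    (∀ h ∈ O, HostSureReach τ z₀ c₀ O h → ‖hostLin H F z₀ c₀ O D h‖ ≤ σ + Y M₀ z₀ c₀ h) →
      ∀ h ∈ O, HostMaybeReach τ z₀ c₀ O h → ∀ h' ∈ hostNear r z₀ O h,
        ‖D h' - D (Pm M₀ z₀ c₀ O h h')‖ ≤ G₁ M₀ z₀ c₀ h h' ∧ ‖D h' + D (Pm M₀ z₀ c₀ O h h') - (2 : ℝ) • D h‖ ≤ G₂ M₀ z₀ c₀ h h'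

/-- THE PAIRED EVALUATION under a pairing `π` and bounds `g` (plain), `g₁` (across-pair), `g₂` (second difference):
`¼ Σ_{h'} (‖B(x_{h'}) + B(x_{π h'})‖·g(π h')² + ‖B(x_{h'})‖·g₁(h')·g₂(h')) + Σ_{h'} T(‖x_{h'}‖, g(h'))`, `x_{h'} = z₀ h' − z₀ h`. -/
noncomputable def pairEval (B : E3 → E3 →L[ℝ] E3 →L[ℝ] E3) (T : ℝ → ℝ → ℝ) (r : ℝ) {M₀ : ℕ} (z₀ : Fin M₀ → E3) (O : Finset (Fin M₀))
    (π : Fin M₀ → Fin M₀) (g g₁ g₂ : Fin M₀ → ℝ) (h : Fin M₀) : ℝ :=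
  (1 / 4 : ℝ) * ∑ h' ∈ hostNear r z₀ O h, (‖B (z₀ h' - z₀ h) + B (z₀ (π h') - z₀ h)‖ * g (π h') ^ 2 + ‖B (z₀ h' - z₀ h)‖ * g₁ h' * g₂ h') +
    ∑ h' ∈ hostNear r z₀ O h, T ‖z₀ h' - z₀ h‖ (g h')

/-- ★★ **THE PAIRED BRIDGE** — `hostQuad(h) ≤ pairEval(π, g, g₁, g₂)(h)` from the three difference bounds, `B` slot-symmetric, `T` monotone, `π` an
involution of the near set. [formal bookkeeping: `norm_half_sum_le_pair` with `v h' = D h' − D h`] -/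
theorem hostQuad_le_pairEval {B : E3 → E3 →L[ℝ] E3 →L[ℝ] E3} (hB : ∀ x u v : E3, B x u v = B x v u) {T : ℝ → ℝ → ℝ} (hT : TMono T) {r : ℝ}
    {M₀ : ℕ} {z₀ : Fin M₀ → E3} {O : Finset (Fin M₀)} {D : Fin M₀ → E3} {h : Fin M₀} {π : Fin M₀ → Fin M₀}
    (hπS : ∀ h' ∈ hostNear r z₀ O h, π h' ∈ hostNear r z₀ O h) (hππ : ∀ h' ∈ hostNear r z₀ O h, π (π h') = h') {g g₁ g₂ : Fin M₀ → ℝ}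
    (hg : ∀ h' ∈ hostNear r z₀ O h, ‖D h' - D h‖ ≤ g h') (hg₁ : ∀ h' ∈ hostNear r z₀ O h, ‖D h' - D (π h')‖ ≤ g₁ h')
    (hg₂ : ∀ h' ∈ hostNear r z₀ O h, ‖D h' + D (π h') - (2 : ℝ) • D h‖ ≤ g₂ h') :
    hostQuad B T r z₀ O D h ≤ pairEval B T r z₀ O π g g₁ g₂ h := by
  unfold hostQuad pairEval
  refine add_le_add ?_ (Finset.sum_le_sum fun h' hh' => hT _ _ _ (norm_nonneg _) (hg h' hh'))
  have h₁ : ∀ h' ∈ hostNear r z₀ O h, ‖(D h' - D h) - (D (π h') - D h)‖ ≤ g₁ h' := fun h' hh' => by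
    rw [show (D h' - D h) - (D (π h') - D h) = D h' - D (π h') by abel]; exact hg₁ h' hh'
  have h₂ : ∀ h' ∈ hostNear r z₀ O h, ‖(D h' - D h) + (D (π h') - D h)‖ ≤ g₂ h' := fun h' hh' => by
    rw [show (D h' - D h) + (D (π h') - D h) = D h' + D (π h') - (2 : ℝ) • D h by rw [two_smul]; abel]; exact hg₂ h' hh'
  exact norm_half_sum_le_pair (hostNear r z₀ O h) (fun h' => B (z₀ h' - z₀ h)) (fun h' => hB _) (fun h' => D h' - D h) π hπS hππ hg h₁ h₂

/-- ★ **(PEVAL) `PairEvalTab 𝓘 τ B T r Pm G G₁ G₂ P`** [INSTRUMENTABLE · closed-form arithmetic per host cell and occupancy]: the paired evaluation of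
the tables is `≤ P` at every maybe-reach row. -/
def PairEvalTab (𝓘 : ChartFam) (τ : ℝ) (B : E3 → E3 →L[ℝ] E3 →L[ℝ] E3) (T : ℝ → ℝ → ℝ) (r : ℝ) (Pm : PairMap) (G G₁ G₂ : DiffTab) (P : SlackTab) :
    Prop :=
  ∀ (M₀ : ℕ) (z₀ : Fin M₀ → E3) (c₀ : Fin M₀), 𝓘 M₀ z₀ c₀ → ∀ (O : Finset (Fin M₀)) (D : Fin M₀ → E3), HostReading τ z₀ c₀ O D →
    ∀ h ∈ O, HostMaybeReach τ z₀ c₀ O h →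
      pairEval B T r z₀ O (Pm M₀ z₀ c₀ O h) (G M₀ z₀ c₀ h) (G₁ M₀ z₀ c₀ h) (G₂ M₀ z₀ c₀ h) h ≤ P M₀ z₀ c₀ h

/-- ★★★ **`hostStepTab_of_pairTab`** — (HDIFF G) ∧ (HPAIR Pm G₁ G₂) on the column `Y`, an admissible pairing, and (PEVAL ≤ P) ⟹ (HSTEP-tab Y P):
EVERY instrument is a linear-objective sup over the GLOBAL row polytope or table arithmetic. [formal bookkeeping: the paired bridge] -/
theorem hostStepTab_of_pairTab {𝓘 : ChartFam} {τ σ r : ℝ} {B : E3 → E3 →L[ℝ] E3 →L[ℝ] E3} (hB : ∀ x u v : E3, B x u v = B x v u)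
    {T : ℝ → ℝ → ℝ} (hT : TMono T) {H : HessTab} {F : ForceTab} {Y P : SlackTab} {Pm : PairMap} (hPm : PairAdm r Pm) {G G₁ G₂ : DiffTab}
    (hG : HostDiffTab 𝓘 τ σ r H F Y G) (hG₁₂ : HostPairTab 𝓘 τ σ r H F Y Pm G₁ G₂) (hP : PairEvalTab 𝓘 τ B T r Pm G G₁ G₂ P) :
    HostStepTab 𝓘 τ σ B T r H F Y P :=
  fun M₀ z₀ c₀ hI O D hR hL h hh hm =>
    (hostQuad_le_pairEval (g := G M₀ z₀ c₀ h) (g₁ := G₁ M₀ z₀ c₀ h) (g₂ := G₂ M₀ z₀ c₀ h) (π := Pm M₀ z₀ c₀ O h) hB hT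
      (fun h' hh' => (hPm M₀ z₀ c₀ O h h' hh').1) (fun h' hh' => (hPm M₀ z₀ c₀ O h h' hh').2)
      (hG M₀ z₀ c₀ hI O D hR hL h hh hm) (fun h' hh' => (hG₁₂ M₀ z₀ c₀ hI O D hR hL h hh hm h' hh').1)
      (fun h' hh' => (hG₁₂ M₀ z₀ c₀ hI O D hR hL h hh hm h' hh').2)).trans (hP M₀ z₀ c₀ hI O D hR h hh hm)

/-- ★ THE BASE RANGE OF THE PAIR TABLES: `(2τ, 4τ)` are valid pair tables for every admissible pairing. [formal bookkeeping: `‖D‖ ≤ τ` on `O`] -/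
theorem hostPairTab_box (𝓘 : ChartFam) {τ : ℝ} (σ : ℝ) {r : ℝ} (H : HessTab) (F : ForceTab) (Y : SlackTab) {Pm : PairMap} (hPm : PairAdm r Pm) :
    HostPairTab 𝓘 τ σ r H F Y Pm (boxTab τ) (fun _ _ _ _ _ => 4 * τ) := by
  intro M₀ z₀ c₀ _ O D hR _ h hh _ h' hh'
  have h₀ := hR.2.2.2.1 h hh
  have h₁ := hR.2.2.2.1 h' (mem_of_mem_hostNear hh')
  have h₂ := hR.2.2.2.1 _ (mem_of_mem_hostNear (hPm M₀ z₀ c₀ O h h' hh').1)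
  have h2n : ‖(2 : ℝ) • D h‖ = 2 * ‖D h‖ := by rw [norm_smul, Real.norm_of_nonneg (by norm_num : (0 : ℝ) ≤ 2)]
  refine ⟨?_, ?_⟩
  · simp only [boxTab]; linarith [norm_sub_le (D h') (D (Pm M₀ z₀ c₀ O h h'))]
  · beta_reduce
    linarith [norm_sub_le (D h' + D (Pm M₀ z₀ c₀ O h h')) ((2 : ℝ) • D h), norm_add_le (D h') (D (Pm M₀ z₀ c₀ O h h'))]

/-- (HPAIR) is MONOTONE in both tables and ANTITONE in the column. [formal bookkeeping] -/
theorem HostPairTab.mono {𝓘 : ChartFam} {τ σ r : ℝ} {H : HessTab} {F : ForceTab} {Y Y' : SlackTab} {Pm : PairMap} {G₁ G₁' G₂ G₂' : DiffTab}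
    (hY : ∀ (M₀ : ℕ) (z₀ : Fin M₀ → E3) (c₀ h : Fin M₀), Y' M₀ z₀ c₀ h ≤ Y M₀ z₀ c₀ h)
    (h₁ : ∀ (M₀ : ℕ) (z₀ : Fin M₀ → E3) (c₀ h h' : Fin M₀), G₁ M₀ z₀ c₀ h h' ≤ G₁' M₀ z₀ c₀ h h')
    (h₂ : ∀ (M₀ : ℕ) (z₀ : Fin M₀ → E3) (c₀ h h' : Fin M₀), G₂ M₀ z₀ c₀ h h' ≤ G₂' M₀ z₀ c₀ h h') (h : HostPairTab 𝓘 τ σ r H F Y Pm G₁ G₂) :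
    HostPairTab 𝓘 τ σ r H F Y' Pm G₁' G₂' :=
  fun M₀ z₀ c₀ hI O D hR hL h₀ hh hm h' hh' =>
    have hL' : ∀ h'' ∈ O, HostSureReach τ z₀ c₀ O h'' → ‖hostLin H F z₀ c₀ O D h''‖ ≤ σ + Y M₀ z₀ c₀ h'' :=
      fun h'' hh'' hs => (hL h'' hh'' hs).trans (by linarith [hY M₀ z₀ c₀ h''])
    ⟨(h M₀ z₀ c₀ hI O D hR hL' h₀ hh hm h' hh').1.trans (h₁ M₀ z₀ c₀ h₀ h'), (h M₀ z₀ c₀ hI O D hR hL' h₀ hh hm h' hh').2.trans (h₂ M₀ z₀ c₀ h₀ h')⟩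

/-! ## §4. The T-leaf record with every stage certified by difference / pair tables -/

/-- A STAGE CERTIFICATE in table currency on the column `Y` with target table `P'`: difference tables, pair tables, and the paired evaluation. -/
def StageCert (𝓘 : ChartFam) (τ σ : ℝ) (B : E3 → E3 →L[ℝ] E3 →L[ℝ] E3) (T : ℝ → ℝ → ℝ) (r : ℝ) (H : HessTab) (F : ForceTab) (Pm : PairMap)
    (Y P' : SlackTab) : Prop :=
  ∃ G G₁ G₂ : DiffTab, HostDiffTab 𝓘 τ σ r H F Y G ∧ HostPairTab 𝓘 τ σ r H F Y Pm G₁ G₂ ∧ PairEvalTab 𝓘 τ B T r Pm G G₁ G₂ P'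

/-- A stage certificate is a per-row host step. [formal bookkeeping] -/
theorem hostStepTab_of_stageCert {𝓘 : ChartFam} {τ σ r : ℝ} {B : E3 → E3 →L[ℝ] E3 →L[ℝ] E3} (hB : ∀ x u v : E3, B x u v = B x v u)
    {T : ℝ → ℝ → ℝ} (hT : TMono T) {H : HessTab} {F : ForceTab} {Pm : PairMap} (hPm : PairAdm r Pm) {Y P' : SlackTab}
    (h : StageCert 𝓘 τ σ B T r H F Pm Y P') : HostStepTab 𝓘 τ σ B T r H F Y P' := by
  obtain ⟨G, G₁, G₂, hG, hG₁₂, hP⟩ := h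
  exact hostStepTab_of_pairTab hB hT hPm hG hG₁₂ hP

/-- ★★★ **THE T-LEAF RECORD IN TABLE CURRENCY** — `[CORE-FAR]` from: the cover, `2τ < s₀`, host separation, `r + 2τ ≤ 7`, (HFAR), (TAILCERT), a
dominating column `X ≥ Xh + Xe`, an admissible pairing, the START table certified by BOX EVALUATION, `n` stages each certified by difference / pair
tables on the column `addCol X (P i)` (LPs on the global polytope) and table arithmetic, and the terminal certificate on `addCol X (P n)`.
[formal bookkeeping: `coreOff_of_envelope_tailCert_tab` + §§1–3] -/
theorem coreOff_of_envelope_tailCert_pairTabs {𝓘 : ChartFam} {τ s₀ r : ℝ} {X Xh Xe : SlackTab} {Pm : PairMap} (P : ℕ → SlackTab) (n : ℕ)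
    (hτ : 0 ≤ τ) (hcov : FamilyCover 𝓘 (24 / 5) (1 / 100) (1 / 8) τ) (hτs : 2 * τ < s₀) (hsep : HostSep 𝓘 s₀) (hr7 : r + 2 * τ ≤ 7)
    (hH : HostFarTab 𝓘 τ r Xh) (hT : TailCert 𝓘 τ Xe)
    (hdom : ∀ (M₀ : ℕ) (z₀ : Fin M₀ → E3) (c₀ h : Fin M₀), Xh M₀ z₀ c₀ h + Xe M₀ z₀ c₀ h ≤ X M₀ z₀ c₀ h) (hPm : PairAdm r Pm)
    (h0 : DiffEvalTab 𝓘 τ bondD3 (cubicTail fun s => gammaMaj (s - 2 * τ)) r (boxTab τ) (P 0))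
    (hs : ∀ i : ℕ, i < n → StageCert 𝓘 τ sigmaOne bondD3 (cubicTail fun s => gammaMaj (s - 2 * τ)) r hessBlk0 force0 Pm (addCol X (P i)) (P (i + 1)))
    (hcert : SlackCert 𝓘 τ 0 sigmaOne hessBlk0 force0 (addCol X (P n))) : CoreOffTubeFloor (63 / 10) (63 / 10) (24 / 5) (1 / 100) 0 :=
  coreOff_of_envelope_tailCert_tab P n hτ hcov hτs hsep hr7 hH hT hdom
    (hostTopTab_of_diffEvalTab_box (tMono_cubicTail_gammaMaj τ) h0)
    (fun i hi => hostStepTab_of_stageCert bondD3_symm (tMono_cubicTail_gammaMaj τ) hPm (hs i hi)) hcert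

/-- ★★★ **THE PINNED RECORD** (`τ = 1/100`, the family `FamP` through the AND-node of record's cover leaf is NOT assumed here — the cover enters as
the hypothesis `hcov` exactly as in R1⁗). One-stage form (`n = 1`), the shape the census instruments first: START by box evaluation, ONE global
LP stage, terminal certificate. [formal bookkeeping] -/
theorem coreOff_of_envelope_tailCert_oneStage {𝓘 : ChartFam} {τ s₀ r : ℝ} {X Xh Xe : SlackTab} {Pm : PairMap} (P₀ P₁ : SlackTab)
    (hτ : 0 ≤ τ) (hcov : FamilyCover 𝓘 (24 / 5) (1 / 100) (1 / 8) τ) (hτs : 2 * τ < s₀) (hsep : HostSep 𝓘 s₀) (hr7 : r + 2 * τ ≤ 7)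
    (hH : HostFarTab 𝓘 τ r Xh) (hT : TailCert 𝓘 τ Xe)
    (hdom : ∀ (M₀ : ℕ) (z₀ : Fin M₀ → E3) (c₀ h : Fin M₀), Xh M₀ z₀ c₀ h + Xe M₀ z₀ c₀ h ≤ X M₀ z₀ c₀ h) (hPm : PairAdm r Pm)
    (h0 : DiffEvalTab 𝓘 τ bondD3 (cubicTail fun s => gammaMaj (s - 2 * τ)) r (boxTab τ) P₀)
    (h1 : StageCert 𝓘 τ sigmaOne bondD3 (cubicTail fun s => gammaMaj (s - 2 * τ)) r hessBlk0 force0 Pm (addCol X P₀) P₁)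
    (hcert : SlackCert 𝓘 τ 0 sigmaOne hessBlk0 force0 (addCol X P₁)) : CoreOffTubeFloor (63 / 10) (63 / 10) (24 / 5) (1 / 100) 0 :=
  coreOff_of_envelope_tailCert_pairTabs (Pm := Pm) (fun i => if i = 0 then P₀ else P₁) 1 hτ hcov hτs hsep hr7 hH hT hdom hPm (by simpa using h0)
    (fun i hi => by
      have hi0 : i = 0 := by omega
      subst hi0
      simpa using h1)
    (by simpa using hcert)

end Summit.AtomisticToContinuum.Crystallization.Theorems.FrustratedLawDichotomyStrainedPatchGradStep
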